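import Summits.Ventures.PercRepro.C025ProfileHallDelete

/-!
# C-032 / C-033 — the profile prices at EVERY `q` across a single-element deletion / contraction (night-3 g7)

With `Pq q p u = [u ≤ p]·C(p+q,u)/C(p+q,q)` (C025ProfileHallDelete) and `price_eq_Pq`, the three price facts that the
parallel-pair steps of the rows `q = 1` (C025ProfileParallel / C025ProfileHallParallel, g6) used in the `P1`/`P0`
vocabulary, now at every `q`:

* `Pq_mono_p`: for `q ≤ u` the price is monotone in the rank of the complement;
* `Pq_lemmaE`: the level-wise Lemma E — `Pq (q+1) (p+1) (u+1) ≤ Pq q p u` for `q ≤ u`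
  (`C(m,u)/C(m,q)` against `C(m+2,u+1)/C(m+2,q+1)`, ratio `(u+1)(m+1−u)/((q+1)(m+1−q)) ≥ 1`);
* (G1) `price_eq_price_delete_of_mem_closure_gen`: `e ∈ cl((E∖e)∖B)` ⟹ the `M`- and `M ＼ e`-prices of `B` agree;
* (G2) `price_insert_le_price_contract_gen`: `price_M (q+1) (u+1) (insert e D) ≤ price_{M／e} q u D` for every `D ⊆ E ∖ e`;
* (G3) `price_pair_le_gen`: `price_M (q+1) (u+1) B + price_M (q+1) (u+1) (insert e B) ≤ price_{M＼e} (q+1) (u+1) B + price_{M／e} q u B`.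
-/

open scoped Matroid

namespace PercRepro

open Set Finset ThmH

section PqGen

/-- The price is monotone in the rank of the complement when `q ≤ u`. -/
theorem Pq_mono_p {q u p p' : ℕ} (hqu : q ≤ u) (hpp : p ≤ p') : Pq q p u ≤ Pq q p' u := by
  unfold Pq
  by_cases hup : u ≤ p
  · rw [if_pos hup, if_pos (hup.trans hpp)]
    -- C(p+q,u)/C(p+q,q) ≤ C(p'+q,u)/C(p'+q,q): induction on p' − p through one step
    obtain ⟨d, rfl⟩ : ∃ d, p' = p + d := ⟨p' - p, by omega⟩
    clear hpp
    induction d with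
    | zero => exact le_rfl
    | succ d ih =>
      refine ih.trans ?_
      -- one step: m := p + d + q; C(m,u)/C(m,q) ≤ C(m+1,u)/C(m+1,q)
      set m := p + d + q with hm
      have hm1 : p + (d + 1) + q = m + 1 := by omega
      rw [hm1]
      have hqm : q ≤ m := by omega
      have hum : u ≤ m := by omega
      have h1 : (0 : ℚ) < Nat.choose m q := by exact_mod_cast Nat.choose_pos hqm
      have h2 : (0 : ℚ) < Nat.choose (m + 1) q := by exact_mod_cast Nat.choose_pos (by omega)
      rw [div_le_div_iff₀ h1 h2]
      -- C(m,u)·C(m+1,q) ≤ C(m+1,u)·C(m,q): multiply by (m+1−u)(m+1−q) and use choose_mul_succ_eq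
      have hu' := Nat.choose_mul_succ_eq m u   -- C(m,u)·(m+1) = C(m+1,u)·(m+1−u)
      have hq' := Nat.choose_mul_succ_eq m q   -- C(m,q)·(m+1) = C(m+1,q)·(m+1−q)
      have key : Nat.choose m u * Nat.choose (m + 1) q * (m + 1 - q) * (m + 1 - u) ≤
          Nat.choose (m + 1) u * Nat.choose m q * (m + 1 - q) * (m + 1 - u) := by
        calc Nat.choose m u * Nat.choose (m + 1) q * (m + 1 - q) * (m + 1 - u)
            = Nat.choose m u * (Nat.choose (m + 1) q * (m + 1 - q)) * (m + 1 - u) := by ring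
          _ = Nat.choose m u * (Nat.choose m q * (m + 1)) * (m + 1 - u) := by rw [← hq']
          _ = (Nat.choose m u * (m + 1)) * Nat.choose m q * (m + 1 - u) := by ring
          _ = (Nat.choose (m + 1) u * (m + 1 - u)) * Nat.choose m q * (m + 1 - u) := by rw [hu']
          _ ≤ (Nat.choose (m + 1) u * (m + 1 - q)) * Nat.choose m q * (m + 1 - u) := by
              apply Nat.mul_le_mul_right
              apply Nat.mul_le_mul_right
              exact Nat.mul_le_mul_left _ (by omega)
          _ = Nat.choose (m + 1) u * Nat.choose m q * (m + 1 - q) * (m + 1 - u) := by ring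
      have hpos : 0 < (m + 1 - q) * (m + 1 - u) := Nat.mul_pos (by omega) (by omega)
      have key' : Nat.choose m u * Nat.choose (m + 1) q ≤ Nat.choose (m + 1) u * Nat.choose m q := by
        apply Nat.le_of_mul_le_mul_right _ hpos
        calc Nat.choose m u * Nat.choose (m + 1) q * ((m + 1 - q) * (m + 1 - u))
            = Nat.choose m u * Nat.choose (m + 1) q * (m + 1 - q) * (m + 1 - u) := by ring
          _ ≤ Nat.choose (m + 1) u * Nat.choose m q * (m + 1 - q) * (m + 1 - u) := key
          _ = Nat.choose (m + 1) u * Nat.choose m q * ((m + 1 - q) * (m + 1 - u)) := by ring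
      exact_mod_cast key'
  · rw [if_neg hup]
    exact Pq_nonneg _ _ _

/-- **Lemma E for the prices**: `Pq (q+1) (p+1) (u+1) ≤ Pq q p u` for `q ≤ u`. -/
theorem Pq_lemmaE {q p u : ℕ} (hqu : q ≤ u) : Pq (q + 1) (p + 1) (u + 1) ≤ Pq q p u := by
  unfold Pq
  by_cases hup : u ≤ p
  · rw [if_pos (by omega), if_pos hup]
    set m := p + q with hm
    have hm2 : p + 1 + (q + 1) = m + 2 := by omega
    rw [hm2]
    have hqm : q ≤ m := by omega
    have hum : u ≤ m := by omega
    have h1 : (0 : ℚ) < Nat.choose (m + 2) (q + 1) := by exact_mod_cast Nat.choose_pos (by omega)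
    have h2 : (0 : ℚ) < Nat.choose m q := by exact_mod_cast Nat.choose_pos hqm
    rw [div_le_div_iff₀ h1 h2]
    -- C(m+2,u+1)·C(m,q) ≤ C(m,u)·C(m+2,q+1)
    -- identities: C(m+2,u+1)(u+1) = (m+2)C(m+1,u); C(m+1,u)(m+1−u) = C(m,u)(m+1)
    have hu1 := Nat.add_one_mul_choose_eq (m + 1) u   -- (m+2)·C(m+1,u) = C(m+2,u+1)·(u+1)
    have hu2 := Nat.choose_mul_succ_eq m u          -- C(m,u)·(m+1) = C(m+1,u)·(m+1−u)
    have hq1 := Nat.add_one_mul_choose_eq (m + 1) q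
    have hq2 := Nat.choose_mul_succ_eq m q
    have hU : Nat.choose (m + 2) (u + 1) * ((u + 1) * (m + 1 - u)) = (m + 2) * (m + 1) * Nat.choose m u := by
      calc Nat.choose (m + 2) (u + 1) * ((u + 1) * (m + 1 - u))
          = (Nat.choose (m + 1 + 1) (u + 1) * (u + 1)) * (m + 1 - u) := by ring
        _ = ((m + 1 + 1) * Nat.choose (m + 1) u) * (m + 1 - u) := by rw [← hu1]
        _ = (m + 2) * (Nat.choose (m + 1) u * (m + 1 - u)) := by ring
        _ = (m + 2) * (Nat.choose m u * (m + 1)) := by rw [← hu2]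
        _ = (m + 2) * (m + 1) * Nat.choose m u := by ring
    have hQ : Nat.choose (m + 2) (q + 1) * ((q + 1) * (m + 1 - q)) = (m + 2) * (m + 1) * Nat.choose m q := by
      calc Nat.choose (m + 2) (q + 1) * ((q + 1) * (m + 1 - q))
          = (Nat.choose (m + 1 + 1) (q + 1) * (q + 1)) * (m + 1 - q) := by ring
        _ = ((m + 1 + 1) * Nat.choose (m + 1) q) * (m + 1 - q) := by rw [← hq1]
        _ = (m + 2) * (Nat.choose (m + 1) q * (m + 1 - q)) := by ring
        _ = (m + 2) * (Nat.choose m q * (m + 1)) := by rw [← hq2]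
        _ = (m + 2) * (m + 1) * Nat.choose m q := by ring
    -- (q+1)(m+1−q) ≤ (u+1)(m+1−u)  since (u−q)(p−u) ≥ 0
    have hcross : (q + 1) * (m + 1 - q) ≤ (u + 1) * (m + 1 - u) := by
      obtain ⟨a, ha⟩ : ∃ a, u = q + a := ⟨u - q, by omega⟩
      obtain ⟨b, hb⟩ : ∃ b, p = u + b := ⟨p - u, by omega⟩
      subst ha
      rw [hm, hb]
      rw [show q + a + b + q + 1 - q = q + a + b + 1 by omega, show q + a + b + q + 1 - (q + a) = q + b + 1 by omega]
      nlinarith [Nat.zero_le (a * b), Nat.zero_le a, Nat.zero_le b]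
    have hpos : 0 < (u + 1) * (m + 1 - u) * ((q + 1) * (m + 1 - q)) :=
      Nat.mul_pos (Nat.mul_pos (by omega) (by omega)) (Nat.mul_pos (by omega) (by omega))
    have key : Nat.choose (m + 2) (u + 1) * Nat.choose m q ≤ Nat.choose m u * Nat.choose (m + 2) (q + 1) := by
      apply Nat.le_of_mul_le_mul_right _ hpos
      calc Nat.choose (m + 2) (u + 1) * Nat.choose m q * ((u + 1) * (m + 1 - u) * ((q + 1) * (m + 1 - q)))
          = (Nat.choose (m + 2) (u + 1) * ((u + 1) * (m + 1 - u))) * Nat.choose m q * ((q + 1) * (m + 1 - q)) := by ring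
        _ = (m + 2) * (m + 1) * Nat.choose m u * Nat.choose m q * ((q + 1) * (m + 1 - q)) := by rw [hU]
        _ ≤ (m + 2) * (m + 1) * Nat.choose m u * Nat.choose m q * ((u + 1) * (m + 1 - u)) :=
            Nat.mul_le_mul_left _ hcross
        _ = Nat.choose m u * ((m + 2) * (m + 1) * Nat.choose m q) * ((u + 1) * (m + 1 - u)) := by ring
        _ = Nat.choose m u * (Nat.choose (m + 2) (q + 1) * ((q + 1) * (m + 1 - q))) * ((u + 1) * (m + 1 - u)) := by
            rw [hQ]
        _ = Nat.choose m u * Nat.choose (m + 2) (q + 1) * ((u + 1) * (m + 1 - u) * ((q + 1) * (m + 1 - q))) := by ring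
    exact_mod_cast key
  · rw [if_neg (by omega)]
    exact Pq_nonneg _ _ _

end PqGen

section PriceGen

variable {α : Type} [DecidableEq α] {M : Matroid α} [M.Finite]

/-- (G1) For `B ⊆ E ∖ e` with `e ∈ cl((E∖e)∖B)`, the `M`-price and the `M ＼ e`-price agree, every `q`, `u`. -/
theorem price_eq_price_delete_of_mem_closure_gen {e : α} (heE : e ∈ gr M) (q u : ℕ) {B : Finset α}
    (hB : B ⊆ (gr M).erase e) (hcl : e ∈ M.closure ((M.E \ {e}) \ (B : Set α))) :
    Profile.price M q u B = Profile.price (M ＼ ({e} : Set α)) q u B := by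
  rw [price_eq_Pq, price_eq_Pq, coe_sdiff_eq_insert hB heE, gr_delete_singleton'', coe_erase_sdiff,
    delete_singleton_eRk_eq Set.sdiff_subset,
    eRk_insert_eq_of_mem_closure (Set.sdiff_subset.trans Set.sdiff_subset) hcl]

/-- (G2) For every `D ⊆ E ∖ e` (`e` a non-loop) and `q ≤ u`: `price_M (q+1) (u+1) (insert e D) ≤ price_{M／e} q u D`. -/
theorem price_insert_le_price_contract_gen {e : α} (he : M.Indep {e}) {q u : ℕ} (hqu : q ≤ u) (D : Finset α) :
    Profile.price M (q + 1) (u + 1) (insert e D) ≤ Profile.price (M ／ ({e} : Set α)) q u D := by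
  rw [price_eq_Pq, price_eq_Pq, coe_sdiff_insert, gr_contract_singleton, coe_erase_sdiff]
  set X : Set α := (M.E \ {e}) \ (D : Set α) with hX
  have hsub : X ⊆ M.E \ {e} := Set.sdiff_subset
  have hc := contract_singleton_eRk_add_one he hsub
  have hfinX : M.eRk X ≠ ⊤ := by
    rw [← lt_top_iff_ne_top]; exact (M.isRkFinite_set _).eRk_lt_top
  have hfinc : (M ／ ({e} : Set α)).eRk X ≠ ⊤ := by
    rw [← lt_top_iff_ne_top]; exact ((M ／ ({e} : Set α)).isRkFinite_set _).eRk_lt_top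
  set r1 := (M.eRk X).toNat with hr1
  set rc := ((M ／ ({e} : Set α)).eRk X).toNat with hrc
  -- ρ(X) ≤ ρ(insert e X) = ρ_{M/e}(X) + 1
  have hge : r1 ≤ rc + 1 := by
    have : M.eRk X ≤ (M ／ ({e} : Set α)).eRk X + 1 := by
      rw [hc]; exact M.eRk_mono (Set.subset_insert _ _)
    rw [← ENat.coe_toNat hfinX, ← ENat.coe_toNat hfinc] at this
    exact_mod_cast this
  rcases Nat.eq_zero_or_pos r1 with h0 | hpos
  · -- r1 = 0: the M-price is 0 unless u + 1 ≤ 0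
    rw [h0]
    unfold Pq
    rw [if_neg (by omega)]
    exact Pq_nonneg _ _ _
  · obtain ⟨r, hr⟩ : ∃ r, r1 = r + 1 := ⟨r1 - 1, by omega⟩
    rw [hr]
    calc Pq (q + 1) (r + 1) (u + 1) ≤ Pq q r u := Pq_lemmaE hqu
      _ ≤ Pq q rc u := Pq_mono_p hqu (by omega)

/-- (G3) For every `B ⊆ E ∖ e` (`e` a non-loop) and `q ≤ u`:
`price_M (q+1) (u+1) B + price_M (q+1) (u+1) (insert e B) ≤ price_{M＼e} (q+1) (u+1) B + price_{M／e} q u B`. -/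
theorem price_pair_le_gen {e : α} (he : M.Indep {e}) {q u : ℕ} (hqu : q ≤ u) {B : Finset α}
    (hB : B ⊆ (gr M).erase e) :
    Profile.price M (q + 1) (u + 1) B + Profile.price M (q + 1) (u + 1) (insert e B) ≤
      Profile.price (M ＼ ({e} : Set α)) (q + 1) (u + 1) B + Profile.price (M ／ ({e} : Set α)) q u B := by
  have heE : e ∈ gr M := by rw [← Finset.mem_coe, coe_gr]; exact he.subset_ground (Set.mem_singleton e)
  have hins : Profile.price M (q + 1) (u + 1) (insert e B) = Profile.price (M ＼ ({e} : Set α)) (q + 1) (u + 1) B := by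
    rw [price_eq_Pq, price_eq_Pq, coe_sdiff_insert, gr_delete_singleton'', coe_erase_sdiff,
      delete_singleton_eRk_eq Set.sdiff_subset]
  rw [hins, price_eq_Pq (N := M) (q + 1) (u + 1) B, price_eq_Pq (N := M ／ ({e} : Set α)) q u B,
    coe_sdiff_eq_insert hB heE, gr_contract_singleton, coe_erase_sdiff]
  set X : Set α := (M.E \ {e}) \ (B : Set α) with hX
  have hsub : X ⊆ M.E \ {e} := Set.sdiff_subset
  have hc := contract_singleton_eRk_add_one he hsub
  have hfinI : M.eRk (insert e X) ≠ ⊤ := by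
    rw [← lt_top_iff_ne_top]; exact (M.isRkFinite_set _).eRk_lt_top
  have hfinc : (M ／ ({e} : Set α)).eRk X ≠ ⊤ := by
    rw [← lt_top_iff_ne_top]; exact ((M ／ ({e} : Set α)).isRkFinite_set _).eRk_lt_top
  set rI := (M.eRk (insert e X)).toNat with hrI
  set rc := ((M ／ ({e} : Set α)).eRk X).toNat with hrc
  have hrel : rc + 1 = rI := by
    have : ((rc + 1 : ℕ) : ℕ∞) = (rI : ℕ∞) := by
      push_cast
      rw [hrc, hrI, ENat.coe_toNat hfinc, ENat.coe_toNat hfinI]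
      exact hc
    exact_mod_cast this
  rw [← hrel]
  have := Pq_lemmaE (q := q) (p := rc) (u := u) hqu
  linarith

end PriceGen

end PercRepro
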